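import Mathlib
import Summits.ValiantsHypothesis.ValiantsHypothesis.Theorems.TwoProducts.Negative.RankTwoEscapes
import Summits.ValiantsHypothesis.ValiantsHypothesis.Theorems.TwoProducts.Negative.CommonPadding
import Summits.ValiantsHypothesis.ValiantsHypothesis.Theorems.TwoProducts.Negative.RankTwoPaddingClassCover
import Summits.ValiantsHypothesis.ValiantsHypothesis.Theorems.TwoProducts.Negative.RankTwoPaddingMergeKit
import HarnessLib

/-!
# NEGATIVE lane (val-neg-1 g5): COMMON DEEP PADDING respects the BLOCK-MERGE threshold (R5)

Sequel to `Negative/RankTwoPadding.lean` and `Negative/RankTwoPaddingClassCover.lean` (same seat; helper file for crux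
`stmt-ValiantsHypothesis-5906`, filed `--supports`; closes NO item, proves NO summit statement, does NOT prove `TwoProducts`,
`PlanarCellBound` or VP ≠ VNP; 0 `def`s).

`noSmallPermMerge_padding`: if NO lattice-small (`#blockSet ≤ 2^m (t+2)^4`) block merge of the letter family of `(u, v)` is of permutation
type (hypothesis (R5) of the v10…v20 residuals of `Cruxes/TwoProducts/Lines/relation_ladder.lean`, tokens `BlockSmall`, `mergeA`,
`PermutationType.PermType` of the landed `PlanarCell` / `PermutationType` files), then the same holds for the PADDED instance of
`noDatum_padding_spec` with `N ≥ m + 1` at ITS threshold `2^{m+4} (t+2)^4`.  Mechanism: a block `J'` of the padded family missing one of the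
four gadget positions keeps a planted pair `(2n s ∣ 0) ~ (n s ∣ n s)` alive in the merged family (`not_permType_mergeA_of_gadget_outside`);
a block containing all four has block set `⊇ blockSet(old part) + {0,2,…,18,20}·N s` with the `19` translates pairwise disjoint
(`|β|₁ ≤ m |s|₁ < N |s|₁`), so `19 · #blockSet(old) ≤ 16 · 2^m (t+2)^4` makes the old part lattice-small for `(u, v)`, and the old
non-permutation-type witness lifts by zero padding (`not_permType_lift`) and block-position invariance (`permType_mergeA_comm`).  [folklore]
-/

namespace Summit.ValiantsHypothesis.Theorems.TwoProducts.Negative.RankTwoPaddingBlockMerge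

open Finset MvPolynomial
open Summit.ValiantsHypothesis.ValiantsHypothesis.Theorems.NewtonUnitEquations.TwoProducts.FormalLogLinearisation
open Summit.ValiantsHypothesis.ValiantsHypothesis.Theorems.NewtonUnitEquations.TwoProducts.PlanarCell
open Summit.ValiantsHypothesis.ValiantsHypothesis.Theorems.NewtonUnitEquations.TwoProducts.PermutationType
  (msetT PermType RankOneCoincidences)
open Summit.ValiantsHypothesis.Theorems.TwoProducts.Negative.CommonPadding
open Summit.ValiantsHypothesis.Theorems.TwoProducts.Negative.RankTwoPaddingClassCover (append_zero_mem_tuples sum_append_zero)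
open Summit.ValiantsHypothesis.Theorems.TwoProducts.Negative.RankTwoPaddingMergeKit

variable {m k : ℕ}

/-! ### The counting step: nineteen disjoint translates of the old block set -/

/-- **All four gadget positions in the block ⇒ the padded block set is ≥ 19 times the old one** (`N ≥ m + 1`). [folklore] -/
theorem blockSet_card_padding (u v : Fin m → MvPolynomial (Fin 2) ℂ) (hu0 : ∀ j, coeff 0 (u j) = 0)
    (hv0 : ∀ j, coeff 0 (v j) = 0) (hT : (tailSupport u v).Nonempty) {N : ℕ} (hN : m + 1 ≤ N) (w : Fin 4 → MvPolynomial (Fin 2) ℂ)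
    (hw_def : w = fun i : Fin 4 =>
      if (i : ℕ) < 2 then monomial ((2 * N) • ∑ f ∈ tailSupport u v, f) (1 : ℂ) + monomial ((2 * (2 * N)) • ∑ f ∈ tailSupport u v, f) 1
      else monomial ((3 * N) • ∑ f ∈ tailSupport u v, f) (1 : ℂ) + monomial ((2 * (3 * N)) • ∑ f ∈ tailSupport u v, f) 1)
    (J' : Finset (Fin (m + 4))) (hall : ∀ i : Fin 4, Fin.natAdd m i ∈ J') :
    19 * (blockSet (fun j => (u j).support ∪ (v j).support) (Finset.univ.filter fun j : Fin m => Fin.castAdd 4 j ∈ J')).card ≤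
      (blockSet (fun j => (Fin.append u w j).support ∪ (Fin.append v w j).support) J').card := by
  classical
  set s : Expo := ∑ f ∈ tailSupport u v, f with hs_def
  have hs0 : s ≠ 0 := tailSum_ne_zero hu0 hv0 hT
  have hspos : 0 < s 0 + s 1 := by
    obtain ⟨c, hc⟩ := Finsupp.ne_iff.mp hs0
    simp only [Finsupp.coe_zero, Pi.zero_apply] at hc
    rcases (Fin.exists_fin_two (p := fun c => s c ≠ 0)).mp ⟨c, hc⟩ with h | h
    · omega
    · omega
  set J₁ : Finset (Fin m) := Finset.univ.filter fun j : Fin m => Fin.castAdd 4 j ∈ J' with hJ₁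
  set K : Finset ℕ := {0, 2, 3, 4, 5, 6, 7, 8, 9, 10, 11, 12, 13, 14, 15, 16, 17, 18, 20} with hK
  have hKcard : K.card = 19 := by rw [hK]; decide
  have hKdec : ∀ k ∈ K, ∃ k₀ ∈ ({0, 2, 4} : Finset ℕ), ∃ k₁ ∈ ({0, 2, 4} : Finset ℕ), ∃ k₂ ∈ ({0, 3, 6} : Finset ℕ),
      ∃ k₃ ∈ ({0, 3, 6} : Finset ℕ), k = k₀ + k₁ + k₂ + k₃ := by rw [hK]; decide
  -- gadget letters: `c N • s` is a letter (or zero) at gadget position `i` for the admissible coefficients `c`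
  have hlow : ∀ i : Fin 4, (i : ℕ) < 2 → ∀ c ∈ ({0, 2, 4} : Finset ℕ),
      (c * N) • s ∈ insert (0 : Expo) ((Fin.append u w (Fin.natAdd m i)).support ∪ (Fin.append v w (Fin.natAdd m i)).support) := by
    intro i hi c hc
    have hwi : w i = monomial ((2 * N) • s) (1 : ℂ) + monomial ((2 * (2 * N)) • s) 1 := by simp only [hw_def, hi, if_true]
    simp only [Fin.append_right, Finset.union_idempotent, hwi]
    obtain ⟨h1, h2⟩ := nsmul_mem_support_gadget (s := s) hs0 (show 2 * N ≠ 0 by omega)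
    simp only [Finset.mem_insert, Finset.mem_singleton] at hc
    rcases hc with rfl | rfl | rfl
    · simp
    · exact Finset.mem_insert_of_mem h1
    · rw [show 4 * N = 2 * (2 * N) by ring]; exact Finset.mem_insert_of_mem h2
  have hhigh : ∀ i : Fin 4, ¬ (i : ℕ) < 2 → ∀ c ∈ ({0, 3, 6} : Finset ℕ),
      (c * N) • s ∈ insert (0 : Expo) ((Fin.append u w (Fin.natAdd m i)).support ∪ (Fin.append v w (Fin.natAdd m i)).support) := by
    intro i hi c hc
    have hwi : w i = monomial ((3 * N) • s) (1 : ℂ) + monomial ((2 * (3 * N)) • s) 1 := by simp only [hw_def, hi, if_false]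
    simp only [Fin.append_right, Finset.union_idempotent, hwi]
    obtain ⟨h1, h2⟩ := nsmul_mem_support_gadget (s := s) hs0 (show 3 * N ≠ 0 by omega)
    simp only [Finset.mem_insert, Finset.mem_singleton] at hc
    rcases hc with rfl | rfl | rfl
    · simp
    · exact Finset.mem_insert_of_mem h1
    · rw [show 6 * N = 2 * (3 * N) by ring]; exact Finset.mem_insert_of_mem h2
  -- the map `(β, k) ↦ β + k N s`
  have hmaps : ∀ q ∈ blockSet (fun j => (u j).support ∪ (v j).support) J₁ ×ˢ K,
      (fun q : Expo × ℕ => q.1 + (q.2 * N) • s) q ∈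
        blockSet (fun j => (Fin.append u w j).support ∪ (Fin.append v w j).support) J' := by
    rintro ⟨β, k⟩ hq
    rw [Finset.mem_product] at hq
    obtain ⟨hβ, hk⟩ := hq
    rw [blockSet, Finset.mem_image] at hβ
    obtain ⟨a, ha, rfl⟩ := hβ
    obtain ⟨k₀, hk₀, k₁, hk₁, k₂, hk₂, k₃, hk₃, rfl⟩ := hKdec k hk
    -- the gadget tuple
    let c : Fin 4 → ℕ := fun i => if (i : ℕ) = 0 then k₀ else if (i : ℕ) = 1 then k₁ else if (i : ℕ) = 2 then k₂ else k₃
    let g : Fin 4 → Expo := fun i => (c i * N) • s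
    have hg : ∀ i, g i ∈ insert (0 : Expo)
        ((Fin.append u w (Fin.natAdd m i)).support ∪ (Fin.append v w (Fin.natAdd m i)).support) := by
      intro i
      rcases i with ⟨iv, hiv⟩
      interval_cases iv
      · exact hlow _ (by simp) _ (by simp [c, hk₀])
      · exact hlow _ (by simp) _ (by simp [c, hk₁])
      · exact hhigh _ (by simp) _ (by simp [c, hk₂])
      · exact hhigh _ (by simp) _ (by simp [c, hk₃])
    rw [blockSet, Finset.mem_image]
    refine ⟨Fin.append a g, ?_, ?_⟩
    · rw [tuples, Fintype.mem_piFinset] at ha ⊢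
      intro j
      refine Fin.addCases (fun j => ?_) (fun i => ?_) j
      · simp only [Fin.append_left]; exact ha j
      · have := hg i
        simp only [Fin.append_right] at this ⊢
        exact this
    · rw [blockSum_append]
      have hfilt : (Finset.univ.filter fun i : Fin 4 => Fin.natAdd m i ∈ J') = Finset.univ :=
        Finset.filter_true_of_mem fun i _ => hall i
      rw [hfilt, Fin.sum_univ_four]
      simp only [g, c, Fin.isValue, Fin.val_zero, Fin.val_one, Fin.val_two, show ((3 : Fin 4) : ℕ) = 3 from rfl]
      simp only [show (1 : ℕ) ≠ 0 from by decide, show (2 : ℕ) ≠ 0 from by decide, show (2 : ℕ) ≠ 1 from by decide,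
        show (3 : ℕ) ≠ 0 from by decide, show (3 : ℕ) ≠ 1 from by decide, show (3 : ℕ) ≠ 2 from by decide, if_true, if_false]
      rw [← add_smul, ← add_smul, ← add_smul]
      congr 1
      ring
  have hinj : Set.InjOn (fun q : Expo × ℕ => q.1 + (q.2 * N) • s)
      ↑(blockSet (fun j => (u j).support ∪ (v j).support) J₁ ×ˢ K) := by
    rintro ⟨β, k⟩ hq ⟨β', k'⟩ hq' heq
    simp only [Finset.coe_product, Set.mem_prod, Finset.mem_coe] at hq hq'
    have hdβ := deg_blockSet_le u v J₁ hq.1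
    have hdβ' := deg_blockSet_le u v J₁ hq'.1
    rw [← hs_def] at hdβ hdβ'
    simp only at heq
    have hdeg : (β 0 + β 1) + k * (N * (s 0 + s 1)) = (β' 0 + β' 1) + k' * (N * (s 0 + s 1)) := by
      have h0 := DFunLike.congr_fun heq 0
      have h1 := DFunLike.congr_fun heq 1
      simp only [Finsupp.add_apply, Finsupp.smul_apply, smul_eq_mul] at h0 h1
      calc (β 0 + β 1) + k * (N * (s 0 + s 1)) = (β 0 + k * N * s 0) + (β 1 + k * N * s 1) := by ring
        _ = (β' 0 + k' * N * s 0) + (β' 1 + k' * N * s 1) := by rw [h0, h1]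
        _ = (β' 0 + β' 1) + k' * (N * (s 0 + s 1)) := by ring
    have hkk : k = k' := by
      by_contra hne
      have hND : m * (s 0 + s 1) + (s 0 + s 1) ≤ N * (s 0 + s 1) := by
        have := Nat.mul_le_mul_right (s 0 + s 1) hN
        rwa [Nat.succ_mul] at this
      rcases Nat.lt_or_gt_of_ne hne with hlt | hlt
      · have := Nat.mul_le_mul_right (N * (s 0 + s 1)) (show k + 1 ≤ k' by omega)
        rw [Nat.succ_mul] at this
        omega
      · have := Nat.mul_le_mul_right (N * (s 0 + s 1)) (show k' + 1 ≤ k by omega)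
        rw [Nat.succ_mul] at this
        omega
    subst hkk
    have : β = β' := add_right_cancel heq
    rw [this]
  have := Finset.card_le_card_of_injOn _ hmaps hinj
  rw [Finset.card_product, hKcard] at this
  omega

/-! ### THE TRANSFER -/

/-- **(R5) transfers to the padded instance** (`N ≥ m + 1`): if no lattice-small block merge of the letter family of `(u, v)` is of
permutation type (threshold `2^m (t+2)^4`), then no lattice-small block merge of the padded family is (threshold `2^{m+4} (t+2)^4`).
[folklore] -/
theorem noSmallPermMerge_padding {t : ℕ} (u v : Fin m → MvPolynomial (Fin 2) ℂ)
    (hu : ∀ j, coeff 0 (u j) = 0 ∧ (u j).support.card ≤ t) (hv : ∀ j, coeff 0 (v j) = 0 ∧ (v j).support.card ≤ t)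
    (hT : (tailSupport u v).Nonempty) {N : ℕ} (hN : m + 1 ≤ N) (w : Fin 4 → MvPolynomial (Fin 2) ℂ)
    (hw_def : w = fun i : Fin 4 =>
      if (i : ℕ) < 2 then monomial ((2 * N) • ∑ f ∈ tailSupport u v, f) (1 : ℂ) + monomial ((2 * (2 * N)) • ∑ f ∈ tailSupport u v, f) 1
      else monomial ((3 * N) • ∑ f ∈ tailSupport u v, f) (1 : ℂ) + monomial ((2 * (3 * N)) • ∑ f ∈ tailSupport u v, f) 1)
    (h10 : ∀ (J : Finset (Fin m)) (j₀ : Fin m), j₀ ∈ J →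
      BlockSmall (fun j => (u j).support ∪ (v j).support) J (2 ^ m * (t + 2) ^ 4) →
      ¬ PermType (mergeA (fun j => (u j).support ∪ (v j).support) J j₀)) :
    ∀ (J : Finset (Fin (m + 4))) (j₀ : Fin (m + 4)), j₀ ∈ J →
      BlockSmall (fun j => (Fin.append u w j).support ∪ (Fin.append v w j).support) J (2 ^ (m + 4) * (t + 2) ^ 4) →
      ¬ PermType (mergeA (fun j => (Fin.append u w j).support ∪ (Fin.append v w j).support) J j₀) := by
  classical
  intro J' j₀' hj₀' hsmall hP
  have hu0 : ∀ j, coeff 0 (u j) = 0 := fun j => (hu j).1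
  have hv0 : ∀ j, coeff 0 (v j) = 0 := fun j => (hv j).1
  set s : Expo := ∑ f ∈ tailSupport u v, f with hs_def
  have hs0 : s ≠ 0 := tailSum_ne_zero hu0 hv0 hT
  have h2N : 2 * N ≠ 0 := by omega
  have h3N : 3 * N ≠ 0 := by omega
  -- gadget letters at the gadget positions
  have hA : ∀ (i : Fin 4) (e : Expo), e ∈ (w i).support →
      e ∈ (Fin.append u w (Fin.natAdd m i)).support ∪ (Fin.append v w (Fin.natAdd m i)).support := by
    intro i e he
    rw [Fin.append_right]
    exact Finset.mem_union_left _ he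
  have hw0 : w 0 = monomial ((2 * N) • s) (1 : ℂ) + monomial ((2 * (2 * N)) • s) 1 := by simp [hw_def]
  have hw1 : w 1 = monomial ((2 * N) • s) (1 : ℂ) + monomial ((2 * (2 * N)) • s) 1 := by simp [hw_def]
  have hw2 : w 2 = monomial ((3 * N) • s) (1 : ℂ) + monomial ((2 * (3 * N)) • s) 1 := by simp [hw_def]
  have hw3 : w 3 = monomial ((3 * N) • s) (1 : ℂ) + monomial ((2 * (3 * N)) • s) 1 := by simp [hw_def]
  obtain ⟨hg2a, hg2b⟩ := nsmul_mem_support_gadget (s := s) hs0 h2N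
  obtain ⟨hg3a, hg3b⟩ := nsmul_mem_support_gadget (s := s) hs0 h3N
  have l0a := hA 0 _ (by rw [hw0]; exact hg2a); have l0b := hA 0 _ (by rw [hw0]; exact hg2b)
  have l1a := hA 1 _ (by rw [hw1]; exact hg2a); have l1b := hA 1 _ (by rw [hw1]; exact hg2b)
  have l2a := hA 2 _ (by rw [hw2]; exact hg3a); have l2b := hA 2 _ (by rw [hw2]; exact hg3b)
  have l3a := hA 3 _ (by rw [hw3]; exact hg3a); have l3b := hA 3 _ (by rw [hw3]; exact hg3b)
  have h01 : (Fin.natAdd m (0 : Fin 4) : Fin (m + 4)) ≠ Fin.natAdd m 1 := by simp [Fin.ext_iff]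
  have h23 : (Fin.natAdd m (2 : Fin 4) : Fin (m + 4)) ≠ Fin.natAdd m 3 := by simp [Fin.ext_iff]
  -- case (a): a gadget position outside the block
  by_cases hp0 : Fin.natAdd m (0 : Fin 4) ∈ J'
  swap
  · exact not_permType_mergeA_of_gadget_outside (fun j => (Fin.append u w j).support ∪ (Fin.append v w j).support) J' hj₀'
      hp0 h01.symm hs0 h2N l0a l1a l1b hP
  by_cases hp1 : Fin.natAdd m (1 : Fin 4) ∈ J'
  swap
  · exact not_permType_mergeA_of_gadget_outside (fun j => (Fin.append u w j).support ∪ (Fin.append v w j).support) J' hj₀'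
      hp1 h01 hs0 h2N l1a l0a l0b hP
  by_cases hp2 : Fin.natAdd m (2 : Fin 4) ∈ J'
  swap
  · exact not_permType_mergeA_of_gadget_outside (fun j => (Fin.append u w j).support ∪ (Fin.append v w j).support) J' hj₀'
      hp2 h23.symm hs0 h3N l2a l3a l3b hP
  by_cases hp3 : Fin.natAdd m (3 : Fin 4) ∈ J'
  swap
  · exact not_permType_mergeA_of_gadget_outside (fun j => (Fin.append u w j).support ∪ (Fin.append v w j).support) J' hj₀'
      hp3 h23 hs0 h3N l3a l2a l2b hP
  -- case (b): all four gadget positions in the block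
  have hall : ∀ i : Fin 4, Fin.natAdd m i ∈ J' := by
    intro i; fin_cases i <;> assumption
  have hcount := blockSet_card_padding u v hu0 hv0 hT hN w hw_def J' hall
  obtain ⟨P, hPcard, hPmem⟩ := hsmall
  have hsub : blockSet (fun j => (Fin.append u w j).support ∪ (Fin.append v w j).support) J' ⊆ P := by
    intro β hβ
    rw [blockSet, Finset.mem_image] at hβ
    obtain ⟨a, ha, rfl⟩ := hβ
    exact hPmem a ha
  have hcard' := Finset.card_le_card hsub
  have h16 : 2 ^ (m + 4) * (t + 2) ^ 4 = 16 * (2 ^ m * (t + 2) ^ 4) := by ring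
  have hsmall₁ : BlockSmall (fun j => (u j).support ∪ (v j).support)
      (Finset.univ.filter fun j : Fin m => Fin.castAdd 4 j ∈ J') (2 ^ m * (t + 2) ^ 4) := by
    refine ⟨blockSet (fun j => (u j).support ∪ (v j).support) (Finset.univ.filter fun j : Fin m => Fin.castAdd 4 j ∈ J'), ?_,
      fun a ha => Finset.mem_image_of_mem _ ha⟩
    rw [h16] at hPcard
    omega
  rcases (Finset.univ.filter fun j : Fin m => Fin.castAdd 4 j ∈ J').eq_empty_or_nonempty with hJe | ⟨j₁, hj₁⟩
  · -- no old position in the block: the original family itself is not of permutation type (singleton merge), and lifts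
    obtain ⟨e, he⟩ := hT
    have hj : ∃ j : Fin m, True := by
      unfold tailSupport at he
      rcases Finset.mem_union.1 he with he | he <;>
      · obtain ⟨j, -, -⟩ := Finset.mem_biUnion.1 he; exact ⟨j, trivial⟩
    obtain ⟨j, -⟩ := hj
    have hold : ∀ i : Fin m, Fin.castAdd 4 i ∉ J' := by
      intro i hi
      have : i ∈ (Finset.univ.filter fun j : Fin m => Fin.castAdd 4 j ∈ J') :=
        Finset.mem_filter.2 ⟨Finset.mem_univ _, hi⟩
      rw [hJe] at this
      exact Finset.notMem_empty _ this
    refine not_permType_lift (B := mergeA (fun j => (u j).support ∪ (v j).support) {j} j)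
      (B' := mergeA (fun j => (Fin.append u w j).support ∪ (Fin.append v w j).support) J' j₀')
      (fun i => ?_) (h10 {j} j (Finset.mem_singleton_self j) (blockSmall_singleton u v hu hv j)) hP
    rw [mergeA_apply_of_not_mem _ J' hj₀' (hold i)]
    simp only [Fin.append_left]
    exact mergeA_singleton_subset u v j i
  · -- an old position in the block: move the block there, restrict, lift
    have hj₁' : (Fin.castAdd 4 j₁ : Fin (m + 4)) ∈ J' := (Finset.mem_filter.1 hj₁).2
    have hP' := permType_mergeA_comm _ J' hj₀' hj₁' hP
    exact not_permType_lift (mergeA_subset_padding u v w J' j₁) (h10 _ j₁ hj₁ hsmall₁) hP'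

end Summit.ValiantsHypothesis.Theorems.TwoProducts.Negative.RankTwoPaddingBlockMerge
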